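import Mathlib
import Literature.Analysis.SpecialFunctions.BesselHeatKernelDuhamelDeriv
import Literature.Analysis.SpecialFunctions.BesselHeatKernelDuhamelEndpoints
import HarnessLib

/-!
# The one-step Duhamel identity between radial heat kernels of different index

For `0 ≤ μ ≤ ν` with `μ + ν > 0` and `t, x, y > 0`, the kernels `q^{(κ)}_t(x,y) = t⁻¹e^{-(x²+y²)/2t} I_κ(xy/t)` of
`BesselHeatKernel.lean` satisfy
  `q^{(μ)}_t(x,y) - q^{(ν)}_t(x,y) = (ν² - μ²)/2 · ∫_0^t ∫_0^∞ q^{(ν)}_{t-s}(x,z) q^{(μ)}_s(y,z) z⁻¹ dz ds`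
(`besselHeatKernel_sub_eq_integral`), i.e. `q^{(μ)} - q^{(ν)} = (u_ν - u_μ) · q^{(ν)} V ∗ q^{(μ)}` with `V(z) = z⁻²`,
`u_κ = κ²/2`, convolution in time and in space with respect to `z dz`: the resolvent/Duhamel identity for the two radial
generators `L_μ - L_ν = (ν² - μ²)/(2z²)`.  Proof: the Chapman–Kolmogorov pairing `D(s) = ∫ q^{(ν)}_{t-s}(x,z) q^{(μ)}_s(y,z) z dz`
has `D′ = (ν²-μ²)/2 · E ≥ 0` on `(0,t)` (`hasDerivAt_duhamelPairing`, Green's identity) and the endpoint limits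
`D(0⁺) = q^{(ν)}_t(x,y)`, `D(t⁻) = q^{(μ)}_t(x,y)` (approximate identity); the fundamental theorem of calculus on
`[a,b] ⊂ (0,t)` and monotone convergence (`AECover`) give the identity together with the integrability of the
inner integral `E` on `(0,t)` (`integrableOn_duhamelDensity`, for `μ < ν`).  This is the analytic core of the comparison
of Bessel-process kernels of different index behind the Hartman–Watson law [RevuzYor1999, Ch. XI §1; Yor1980].

## References
* D. Revuz, M. Yor, *Continuous Martingales and Brownian Motion*, 3rd ed. (1999), Ch. XI §1. [RevuzYor1999]
-/

noncomputable section

open Filter Topology Real MeasureTheory Set Metric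
open scoped Nat BigOperators

namespace Literature.Analysis.SpecialFunctions

section Duhamel

variable {μ ν t x y : ℝ}

/-- The inner integral `E(s) = ∫_0^∞ q^{(ν)}_{t-s}(x,z) q^{(μ)}_s(y,z) z⁻¹ dz` is nonnegative. [cite: RevuzYor1999, Ch. XI §1] -/
theorem duhamelDensity_nonneg (hμ : 0 ≤ μ) (hν : 0 ≤ ν) (hx : 0 < x) (hy : 0 < y) {s : ℝ} (hs : 0 < s) (hst : s < t) :
    0 ≤ ∫ z in Ioi (0 : ℝ), besselHeatKernel ν (t - s) x z * besselHeatKernel μ s y z / z :=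
  setIntegral_nonneg measurableSet_Ioi fun z hz =>
    div_nonneg (mul_nonneg (besselHeatKernel_pos hν (by linarith) hx hz).le (besselHeatKernel_pos hμ hs hy hz).le)
      (le_of_lt hz)

/-- **FTC on a compact sub-interval**: for `0 < a ≤ b < t`,
`D(b) - D(a) = (ν²-μ²)/2 ∫_a^b E(s) ds` and `E` is integrable on `(a,b]` (when `μ ≤ ν`). [cite: RevuzYor1999, Ch. XI §1] -/
theorem duhamelPairing_sub_eq_integral (hμ : 0 ≤ μ) (hμν' : μ ≤ ν) (hμν : 0 < μ + ν) (ht : 0 < t) (hx : 0 < x)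
    (hy : 0 < y) {a b : ℝ} (ha : 0 < a) (hab : a ≤ b) (hb : b < t) :
    IntegrableOn (fun s => (ν ^ 2 - μ ^ 2) / 2 *
        ∫ z in Ioi (0 : ℝ), besselHeatKernel ν (t - s) x z * besselHeatKernel μ s y z / z) (Ioc a b) ∧
      (∫ z in Ioi (0 : ℝ), besselHeatKernel ν (t - b) x z * besselHeatKernel μ b y z * z) -
        (∫ z in Ioi (0 : ℝ), besselHeatKernel ν (t - a) x z * besselHeatKernel μ a y z * z) =
      ∫ s in Ioc a b, (ν ^ 2 - μ ^ 2) / 2 *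
        ∫ z in Ioi (0 : ℝ), besselHeatKernel ν (t - s) x z * besselHeatKernel μ s y z / z := by
  have hν : 0 ≤ ν := hμ.trans hμν'
  have hc : 0 ≤ (ν ^ 2 - μ ^ 2) / 2 := by nlinarith
  have hderiv : ∀ s ∈ Icc a b, HasDerivAt
      (fun s : ℝ => ∫ z in Ioi (0 : ℝ), besselHeatKernel ν (t - s) x z * besselHeatKernel μ s y z * z)
      ((ν ^ 2 - μ ^ 2) / 2 * ∫ z in Ioi (0 : ℝ), besselHeatKernel ν (t - s) x z * besselHeatKernel μ s y z / z) s :=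
    fun s hs => hasDerivAt_duhamelPairing hμ hν hμν ht hx hy (lt_of_lt_of_le ha hs.1) (lt_of_le_of_lt hs.2 hb)
  have hcont : ContinuousOn
      (fun s : ℝ => ∫ z in Ioi (0 : ℝ), besselHeatKernel ν (t - s) x z * besselHeatKernel μ s y z * z) (Icc a b) :=
    fun s hs => (hderiv s hs).continuousAt.continuousWithinAt
  have hnonneg : ∀ s ∈ Ioo a b, 0 ≤ (ν ^ 2 - μ ^ 2) / 2 *
      ∫ z in Ioi (0 : ℝ), besselHeatKernel ν (t - s) x z * besselHeatKernel μ s y z / z := fun s hs =>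
    mul_nonneg hc (duhamelDensity_nonneg hμ hν hx hy (ha.trans hs.1) (hs.2.trans hb))
  have hint : IntegrableOn (fun s => (ν ^ 2 - μ ^ 2) / 2 *
      ∫ z in Ioi (0 : ℝ), besselHeatKernel ν (t - s) x z * besselHeatKernel μ s y z / z) (Ioc a b) :=
    intervalIntegral.integrableOn_deriv_of_nonneg hcont (fun s hs => hderiv s (Ioo_subset_Icc_self hs)) hnonneg
  refine ⟨hint, ?_⟩
  rw [← intervalIntegral.integral_of_le hab,
    intervalIntegral.integral_eq_sub_of_hasDerivAt_of_le hab hcont (fun s hs => hderiv s (Ioo_subset_Icc_self hs))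
      ((intervalIntegrable_iff_integrableOn_Ioc_of_le hab).2 hint)]

/-- **The one-step Duhamel identity** between radial heat kernels of index `0 ≤ μ ≤ ν` (`μ + ν > 0`), `t, x, y > 0`:
`q^{(μ)}_t(x,y) - q^{(ν)}_t(x,y) = (ν²-μ²)/2 ∫_0^t ∫_0^∞ q^{(ν)}_{t-s}(x,z) q^{(μ)}_s(y,z) z⁻¹ dz ds`, together with the
integrability of `s ↦ (ν²-μ²)/2 · E(s)` on `(0,t)`. [cite: RevuzYor1999, Ch. XI §1] -/
theorem besselHeatKernel_sub_eq_integral' (hμ : 0 ≤ μ) (hμν' : μ ≤ ν) (hμν : 0 < μ + ν) (ht : 0 < t) (hx : 0 < x)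
    (hy : 0 < y) :
    IntegrableOn (fun s => (ν ^ 2 - μ ^ 2) / 2 *
        ∫ z in Ioi (0 : ℝ), besselHeatKernel ν (t - s) x z * besselHeatKernel μ s y z / z) (Ioo 0 t) ∧
    besselHeatKernel μ t x y - besselHeatKernel ν t x y =
      ∫ s in Ioo (0 : ℝ) t, (ν ^ 2 - μ ^ 2) / 2 * ∫ z in Ioi (0 : ℝ),
        besselHeatKernel ν (t - s) x z * besselHeatKernel μ s y z / z := by
  have hν : 0 ≤ ν := hμ.trans hμν'
  have hc : 0 ≤ (ν ^ 2 - μ ^ 2) / 2 := by nlinarith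
  -- abbreviations
  set D : ℝ → ℝ := fun s => ∫ z in Ioi (0 : ℝ), besselHeatKernel ν (t - s) x z * besselHeatKernel μ s y z * z with hD
  set G : ℝ → ℝ := fun s => (ν ^ 2 - μ ^ 2) / 2 *
    ∫ z in Ioi (0 : ℝ), besselHeatKernel ν (t - s) x z * besselHeatKernel μ s y z / z with hG
  -- the exhausting sequence of intervals `(a_n, b_n)`, `a_n = t/(n+3) → 0`, `b_n = t - t/(n+3) → t`
  set a : ℕ → ℝ := fun n => t / ((n : ℝ) + 3) with ha
  set b : ℕ → ℝ := fun n => t - t / ((n : ℝ) + 3) with hb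
  have ha0 : ∀ n, 0 < a n := fun n => by rw [ha]; positivity
  have hale : ∀ n, a n ≤ t / 3 := fun n => by
    rw [ha]; exact div_le_div_of_nonneg_left ht.le (by norm_num) (by linarith [n.cast_nonneg (α := ℝ)])
  have hab : ∀ n, a n ≤ b n := fun n => by simp only [hb]; linarith [hale n]
  have hbt : ∀ n, b n < t := fun n => by simp only [hb]; linarith [ha0 n]
  have ha_lim : Tendsto a atTop (𝓝 0) := by
    rw [ha]
    exact tendsto_const_nhds.div_atTop
      (tendsto_atTop_add_const_right _ 3 tendsto_natCast_atTop_atTop)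
  have hb_lim : Tendsto b atTop (𝓝 t) := by
    have := tendsto_const_nhds (x := t) |>.sub ha_lim
    rw [sub_zero] at this
    exact this
  -- FTC on each `[a_n, b_n]`
  have hFTC : ∀ n, IntegrableOn G (Ioc (a n) (b n)) ∧ D (b n) - D (a n) = ∫ s in Ioc (a n) (b n), G s := fun n =>
    duhamelPairing_sub_eq_integral hμ hμν' hμν ht hx hy (ha0 n) (hab n) (hbt n)
  -- endpoint limits along the sequence
  have hDa : Tendsto (fun n => D (a n)) atTop (𝓝 (besselHeatKernel ν t x y)) := by
    have h := tendsto_duhamelPairing_zero hμ hν ht hx hy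
    refine h.comp (tendsto_nhdsWithin_iff.2 ⟨ha_lim, Eventually.of_forall fun n => ha0 n⟩)
  have hDb : Tendsto (fun n => D (b n)) atTop (𝓝 (besselHeatKernel μ t x y)) := by
    have h := tendsto_duhamelPairing_top hμ hν ht hx hy
    refine h.comp (tendsto_nhdsWithin_iff.2 ⟨hb_lim, Eventually.of_forall fun n => hbt n⟩)
  have hlim : Tendsto (fun n => ∫ s in Ioc (a n) (b n), G s) atTop
      (𝓝 (besselHeatKernel μ t x y - besselHeatKernel ν t x y)) := by
    have := hDb.sub hDa
    exact this.congr fun n => (hFTC n).2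
  -- the covering and monotone convergence
  have hcover : AECover (volume.restrict (Ioo 0 t)) atTop fun n => Ioc (a n) (b n) :=
    aecover_Ioo_of_Ioc ha_lim hb_lim
  have hrestr : ∀ n, (volume.restrict (Ioo 0 t)).restrict (Ioc (a n) (b n)) = volume.restrict (Ioc (a n) (b n)) := by
    intro n
    rw [Measure.restrict_restrict measurableSet_Ioc, inter_eq_left.2]
    exact fun s hs => ⟨(ha0 n).trans hs.1, lt_of_le_of_lt hs.2 (hbt n)⟩
  have hfi : ∀ n, IntegrableOn G (Ioc (a n) (b n)) (volume.restrict (Ioo 0 t)) := fun n => by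
    rw [IntegrableOn, hrestr n]; exact (hFTC n).1
  have hnng : ∀ᵐ s ∂(volume.restrict (Ioo 0 t)), 0 ≤ G s :=
    ae_restrict_of_forall_mem measurableSet_Ioo fun s hs =>
      mul_nonneg hc (duhamelDensity_nonneg hμ hν hx hy hs.1 hs.2)
  have hbdd : ∀ᶠ n in atTop, (∫ s in Ioc (a n) (b n), G s ∂(volume.restrict (Ioo 0 t))) ≤
      besselHeatKernel μ t x y - besselHeatKernel ν t x y + 1 := by
    have h1 : ∀ᶠ n in atTop, (∫ s in Ioc (a n) (b n), G s) ≤ besselHeatKernel μ t x y - besselHeatKernel ν t x y + 1 :=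
      hlim.eventually (eventually_le_nhds (lt_add_one _))
    filter_upwards [h1] with n hn
    rwa [hrestr n]
  have hInt : Integrable G (volume.restrict (Ioo 0 t)) :=
    hcover.integrable_of_integral_bounded_of_nonneg_ae _ hfi hnng hbdd
  refine ⟨hInt, ?_⟩
  have hlim2 : Tendsto (fun n => ∫ s in Ioc (a n) (b n), G s ∂(volume.restrict (Ioo 0 t))) atTop
      (𝓝 (∫ s in Ioo 0 t, G s)) :=
    hcover.integral_tendsto_of_countably_generated hInt
  have hlim2' : Tendsto (fun n => ∫ s in Ioc (a n) (b n), G s) atTop (𝓝 (∫ s in Ioo 0 t, G s)) :=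
    hlim2.congr fun n => by rw [hrestr n]
  exact tendsto_nhds_unique hlim hlim2'

/-- **The one-step Duhamel identity** (constant pulled out):
`q^{(μ)}_t(x,y) - q^{(ν)}_t(x,y) = (ν²-μ²)/2 · ∫_0^t ∫_0^∞ q^{(ν)}_{t-s}(x,z) q^{(μ)}_s(y,z) z⁻¹ dz ds`.
[cite: RevuzYor1999, Ch. XI §1] -/
theorem besselHeatKernel_sub_eq_integral (hμ : 0 ≤ μ) (hμν' : μ ≤ ν) (hμν : 0 < μ + ν) (ht : 0 < t) (hx : 0 < x)
    (hy : 0 < y) :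
    besselHeatKernel μ t x y - besselHeatKernel ν t x y =
      (ν ^ 2 - μ ^ 2) / 2 * ∫ s in Ioo (0 : ℝ) t, ∫ z in Ioi (0 : ℝ),
        besselHeatKernel ν (t - s) x z * besselHeatKernel μ s y z / z := by
  rw [(besselHeatKernel_sub_eq_integral' hμ hμν' hμν ht hx hy).2, integral_const_mul]

/-- **Integrability of the Duhamel density**: for `0 ≤ μ < ν`, `s ↦ ∫_0^∞ q^{(ν)}_{t-s}(x,z) q^{(μ)}_s(y,z) z⁻¹ dz` is
integrable on `(0,t)`, with integral `(q^{(μ)}_t(x,y) - q^{(ν)}_t(x,y)) / ((ν²-μ²)/2)`. [cite: RevuzYor1999, Ch. XI §1] -/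
theorem integrableOn_duhamelDensity (hμ : 0 ≤ μ) (hμν' : μ < ν) (ht : 0 < t) (hx : 0 < x) (hy : 0 < y) :
    IntegrableOn (fun s => ∫ z in Ioi (0 : ℝ), besselHeatKernel ν (t - s) x z * besselHeatKernel μ s y z / z)
        (Ioo 0 t) ∧
      ∫ s in Ioo (0 : ℝ) t, ∫ z in Ioi (0 : ℝ), besselHeatKernel ν (t - s) x z * besselHeatKernel μ s y z / z =
        (besselHeatKernel μ t x y - besselHeatKernel ν t x y) / ((ν ^ 2 - μ ^ 2) / 2) := by
  have hc : 0 < (ν ^ 2 - μ ^ 2) / 2 := by nlinarith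
  have h := besselHeatKernel_sub_eq_integral' hμ hμν'.le (by linarith) ht hx hy
  refine ⟨?_, ?_⟩
  · have h1 : IntegrableOn (fun s => ((ν ^ 2 - μ ^ 2) / 2)⁻¹ * ((ν ^ 2 - μ ^ 2) / 2 *
        ∫ z in Ioi (0 : ℝ), besselHeatKernel ν (t - s) x z * besselHeatKernel μ s y z / z)) (Ioo 0 t) :=
      h.1.const_mul (((ν ^ 2 - μ ^ 2) / 2)⁻¹)
    refine IntegrableOn.congr_fun h1 (fun s _ => ?_) measurableSet_Ioo
    rw [← mul_assoc, inv_mul_cancel₀ hc.ne', one_mul]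
  · rw [eq_div_iff hc.ne', h.2, integral_const_mul, mul_comm]

end Duhamel

end Literature.Analysis.SpecialFunctions

end
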